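import Summits.QuantumFields.BalabanUV.Beta.MultiscaleCombesThomasL2Real
import Summits.QuantumFields.BalabanUV.Beta.AccretiveCombesThomasSandwichSite

/-!
# `Summit.QuantumFields.BalabanUV.Beta.MultiscaleCombesThomasL2Cells` — the ℓ²-LOCALIZED OPERATOR bound CELL TO CELL for the
# multi-region averaged MODEL operator `levelOp` on the torus: `‖1_{cell k}(levelOp)⁻¹1_{cell k′}‖_{ℓ²→ℓ²} ≤
# e^{−κ(d_n(t_k,t_{k′}) − 4d)}·S_{l_k}S_{l_{k′}}/μ₀` (engine file 7 = file 6 `real_set_norm_inverse_le` fed by co-owner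
# beta-d4-p2's `MultiscaleDecay.hc_levelOp` VERBATIM; the (3.46)₁ SHAPE at MODEL level, level-count- and volume-free)

HONEST FRAMING (page 1 of everything in this cell).  Discharging `FlowStep.BetaPertH` would make Bałaban's ultraviolet
stability UNCONDITIONAL — a constructive-QFT result; it is NOT the continuum limit and NOT the Clay problem.  This module
discharges nothing of `BetaPertH`; it is a ten-line [folklore] corollary, kernel-checked, written by the OWNER of binder row
D4 (unit `b2b-balaban-beta-an4`, gen 43) at the MODEL crew's request (beta-d4-p2-g8, journal l.19687: «the instance corollary:
YOURS, please add it»; placed in a sibling file rather than as a v1.1 of file 6 so that the abstract files 5∕6 keep importing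
no torus machinery).  HONEST DEPENDENCY: continuum YM on T⁴ ⇐ BetaPertH ∧ nine spine estimates (0/9 proved); BetaPertH ⇐
(D1) ∧ (D4) ∧ CAP+tail; G-an2-4 gates asym, D1 and NE2/3/4.

WHAT IS CERTIFIED (kernel, 0 sorry).  In the analytic setting of `MultiscaleDecay.hc_levelOp` — pv21's `levelOp` on the torus
`UT N` with ANY isometric bond matrices `Rm` and level transports `T`, level weights on the cells of a pairwise-disjoint
COVERING cube family (cell `k`: level `l_k`, side `S_{l_k}`, corner `t_k = ctrU (zc k)`), print-size weights from above, `|c| ≤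
c_max`, a cell-sum coercivity `C`, a rate `0 ≤ κ ≤ 1` with `μ₀ = C − 2d·c_max²κ² − a_max(e^{2dκ} − 1) > 0` — for every pair of
cells `k, k′` and every real `u` supported in cell `k′`:
**`real_cellNorm_levelOp_inverse_le`**: `√(Σ_{p ∈ cell k}((levelOp)⁻¹u)_p²) ≤
e^{−κ(d_n(t_k,t_{k′}) − 2d − 2d)} / √((μ₀S_{l_k}⁻²)(μ₀S_{l_{k′}}⁻²)) · √(Σ_{p ∈ cell k′}u_p²)` — i.e.
`‖1_{cell k}(levelOp)⁻¹1_{cell k′}‖_{ℓ²→ℓ²} ≤ e^{4dκ}·S_{l_k}S_{l_{k′}}/μ₀ · e^{−κ d_n(t_k,t_{k′})}`: decay in the scale-adapted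
distance of the cell corners with the geometric-mean LOCAL PREFACTOR, constants seeing `d, c, a, C, κ` only — neither the sides,
nor the levels or their number, nor the volume; LOSS-FREE in the cell cardinalities (no `#cell` factor: file 6's weighted
SOLUTION bound, not the entry bound summed).  Ingredients BY NAME, nothing restated: `MultiscaleCombesThomasL2Real.
real_set_norm_inverse_le` (file 6, p232270), `MultiscaleDecay.hc_levelOp` + `decay_levelOp` (invertibility) (beta-d4-p2,
p230877), `AccretiveCombesThomasSandwichSite.sdist_corner_thresholds` (beta-d4-p3 K4, p232018: the two thresholds `d_n(x,t_{k′})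
≤ 2d` on cell `k′` and `≥ d_n(t_k,t_{k′}) − 2d` on cell `k`, from (K) `MultiscaleDistance` §3).  For the one-prefactor form
(print's `(L^jη)²` at the target) the scale-transfer hypothesis of file 5's `prefactor_transfer` is supplied at MODEL level by
beta-d4-p2's `MultiscaleDistanceGraded.scale_le_scale_mul_exp` (graded cells) — not composed here.

LOCATOR (shape only, nothing printed asserted; ABSOLUTE RULE): [Balaban1985BackgroundPropagators] Thm 3.1 (3.46) p. 398,
first member «‖hG′(U)λ‖ ≦ B₀(L^jη)²|h|e^{−δ₀d(y,y′)}‖λ‖ for supp h ⊂ Δ(y), y ∈ Λ_j, supp λ ⊂ Δ(y′)» — reached here at MODEL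
level (currency precision E-an4-139); print's own route is the random-walk representation (p. 398); the sup-norm members
(3.42)–(3.45) need O.2 item (ii-b) and are NOT here; no Dirichlet holes (the `dirInv` twin goes through beta-d4-p2's
`MultiscaleDecayDirichlet.hc_sandwich` the same way), no print region geometry, nothing of Bałaban's `U_k`, `Ū^l`, vector
operators.  Row D4: NO class change (critical-path width 0; D4 DISCHARGE NO DATE); NOT BetaPertH, NOT continuum, NOT Clay,
NOT summit progress.
-/

open scoped BigOperators
open Finset

namespace Summit.QuantumFields.BalabanUV.Beta.MultiscaleCombesThomasL2Cells

open Summit.QuantumFields.BalabanUV.Beta.MultiscaleCombesThomasL2Real (real_set_norm_inverse_le)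
open Summit.QuantumFields.BalabanUV.Beta.BoxPoincare (Box)
open Summit.QuantumFields.BalabanUV.Beta.MultiscaleCoerciveTorus
open Summit.QuantumFields.BalabanUV.Beta.MultiscaleDistance
open Summit.QuantumFields.BalabanUV.Beta.MultiscaleDecayBudget
open Summit.QuantumFields.BalabanUV.Beta.MultiscaleDecay (hc_levelOp decay_levelOp)
open Summit.QuantumFields.BalabanUV.Beta.AccretiveCombesThomasSandwichSite (sdist_corner_thresholds)
open Literature.MathematicalPhysics.QuantumFieldTheory.Balaban1983to89
open Literature.MathematicalPhysics.QuantumFieldTheory.Balaban1983to89.B9Thm37GluePU (bsrc btgt)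
open Literature.MathematicalPhysics.QuantumFieldTheory.Balaban1983to89.B9Thm37GlueTorusCov (tblk)
open Literature.MathematicalPhysics.QuantumFieldTheory.Balaban1983to89.B9Thm37GlueTorusCovLevels (levelOp)
open B5TorusCover (UT Ctr ctrU)

noncomputable section

variable {d : ℕ} {N : Fin d → ℕ} [∀ i, NeZero (N i)] [NeZero d] {Cp J K : Type} [Fintype Cp] [DecidableEq Cp] [Nonempty Cp]
  [Fintype J] [Fintype K] [DecidableEq K] (S : J → ℕ) (hS : ∀ l, 1 ≤ S l) (hdivS : ∀ l i, S l ∣ N i) (lvl : K → J)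
  (zc : (k : K) → Ctr N (S (lvl k)))

/-! ## The analytic setting of `MultiscaleDecay.hc_levelOp`, as section variables (as in K4 §6) -/

variable
    (hdisj : ∀ k k' v v', cellPt S hS hdivS lvl zc k v = cellPt S hS hdivS lvl zc k' v' → k = k')
    (hcover : ∀ x : UT N, ∃ k, ∃ v : Box d (S (lvl k)), cellPt S hS hdivS lvl zc k v = x)
    (Rm : UT N × Fin d → Cp → Cp → ℝ) (hRm : ∀ b i j, ∑ k, Rm b k i * Rm b k j = if i = j then (1 : ℝ) else 0)
    (T : J → UT N → Cp → Cp → ℝ) (hT : ∀ l x i i', ∑ k, T l x k i * T l x k i' = if i = i' then (1 : ℝ) else 0)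
    (a : J → ℝ) (ha : ∀ j, 0 ≤ a j) (ω : J → UT N → ℝ)
    (hsupp : ∀ l x, ω l (ctrU N (S l) (tblk (hS l) (hdivS l) x)) ≠ 0 → ∃ k v, lvl k = l ∧ cellPt S hS hdivS lvl zc k v = x)
    {amax : ℝ} (hamax : 0 ≤ amax)
    (hscale : ∀ k, a (lvl k) * ω (lvl k) (ctrU N (S (lvl k)) (zc k)) ^ 2 * (S (lvl k) : ℝ) ^ d ≤ amax / (S (lvl k) : ℝ) ^ 2)
    (c : UT N × Fin d → ℝ) {cmax : ℝ} (hc : ∀ b, |c b| ≤ cmax) {C : ℝ}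
    (hcoer : ∀ f : UT N × Cp → ℝ,
      C * ∑ k, ((S (lvl k) : ℝ) ^ 2)⁻¹ * ∑ v : Box d (S (lvl k)), ∑ i, f (cellPt S hS hdivS lvl zc k v, i) ^ 2 ≤
        ∑ p, f p * levelOp bsrc btgt c Rm (fun l x => ctrU N (S l) (tblk (hS l) (hdivS l) x))
          (fun l x => ω l (ctrU N (S l) (tblk (hS l) (hdivS l) x))) T a f p)
    {κ : ℝ} (hκ0 : 0 ≤ κ) (hκ1 : κ ≤ 1)

include hdisj hRm hT ha hsupp hamax hscale hc hcoer hκ0 hκ1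

/-- **THE ℓ²-LOCALIZED OPERATOR BOUND CELL TO CELL for `levelOp` (MODEL; (3.46)₁ SHAPE).**  For cells `k, k′` with corners
`t_k, t_{k′}` and a real `u` supported in cell `k′`:
`√(Σ_{p ∈ cell k}((levelOp)⁻¹u)_p²) ≤ e^{−κ((d_n(t_k,t_{k′}) − 2d) − 2d)}/√((μ₀S_{l_k}⁻²)(μ₀S_{l_{k′}}⁻²))·√(Σ_{p ∈ cell k′}u_p²)`,
`μ₀ = C − 2d·c_max²κ² − a_max(e^{2dκ} − 1) > 0` — file 6's `real_set_norm_inverse_le` with the hypothesis `hc_levelOp` (weight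
`κ·d_n(·, t_{k′})`, profile `μ₀·n⁻²`), the sets = the two cells, floors `ν = μ₀S_{l_k}⁻²`, `ν′ = μ₀S_{l_{k′}}⁻²`, thresholds
`R = d_n(t_k,t_{k′}) − 2d`, `ω = 2d` (K4's `sdist_corner_thresholds`).  In words: `‖1_{cell k}(levelOp)⁻¹1_{cell k′}‖_{ℓ²→ℓ²} ≤
e^{4dκ}·S_{l_k}S_{l_{k′}}/μ₀·e^{−κ d_n(t_k,t_{k′})}`, constants seeing `d, c, a, C, κ` only, no `#cell` factor.
[cite: Balaban1985BackgroundPropagators, Thm 3.1 (3.46) p.398; Balaban1984PropagatorsII, (2.46) p.231] [folklore] -/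
theorem real_cellNorm_levelOp_inverse_le (hμ : 0 < C - 2 * d * cmax ^ 2 * κ ^ 2 - amax * (Real.exp (2 * d * κ) - 1))
    (k k' : K) (u : UT N × Cp → ℝ) (hu : ∀ p, cellOf S hS hdivS lvl zc hcover p.1 ≠ k' → u p = 0) :
    Real.sqrt (∑ p ∈ univ.filter (fun p : UT N × Cp => cellOf S hS hdivS lvl zc hcover p.1 = k),
        (Ring.inverse (levelOp bsrc btgt c Rm (fun l x => ctrU N (S l) (tblk (hS l) (hdivS l) x))
          (fun l x => ω l (ctrU N (S l) (tblk (hS l) (hdivS l) x))) T a)) u p ^ 2) ≤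
      Real.exp (-(κ * (sdist bsrc btgt (siteScale S hS hdivS lvl zc hcover) (ctrU N (S (lvl k)) (zc k))
          (ctrU N (S (lvl k')) (zc k')) - 2 * d - 2 * d))) /
        Real.sqrt ((C - 2 * d * cmax ^ 2 * κ ^ 2 - amax * (Real.exp (2 * d * κ) - 1)) * ((S (lvl k) : ℝ) ^ 2)⁻¹ *
          ((C - 2 * d * cmax ^ 2 * κ ^ 2 - amax * (Real.exp (2 * d * κ) - 1)) * ((S (lvl k') : ℝ) ^ 2)⁻¹)) *
        Real.sqrt (∑ p ∈ univ.filter (fun p : UT N × Cp => cellOf S hS hdivS lvl zc hcover p.1 = k'), u p ^ 2) := by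
  classical
  obtain ⟨i₀⟩ := ‹Nonempty Cp›
  set μ₀ := C - 2 * d * cmax ^ 2 * κ ^ 2 - amax * (Real.exp (2 * d * κ) - 1) with hμ₀
  set A := levelOp bsrc btgt c Rm (fun l x => ctrU N (S l) (tblk (hS l) (hdivS l) x))
    (fun l x => ω l (ctrU N (S l) (tblk (hS l) (hdivS l) x))) T a with hA
  set tk' : UT N := ctrU N (S (lvl k')) (zc k') with htk'
  -- invertibility (first conjunct of the MODEL END)
  have hunit : IsUnit A :=
    (decay_levelOp S hS hdivS lvl zc hdisj hcover Rm hRm T hT a ha ω hsupp hamax hscale c hc hcoer hκ0 hκ1 hμ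
      (tk', i₀) (tk', i₀)).1
  -- the sitewise profile and its positivity
  have hSpos : ∀ l, (0 : ℝ) < (S l : ℝ) := fun l => by exact_mod_cast hS l
  have hμpos : ∀ p : UT N × Cp, 0 < μ₀ * ((siteScale S hS hdivS lvl zc hcover p.1 : ℝ) ^ 2)⁻¹ := fun p =>
    mul_pos hμ (inv_pos.mpr (pow_pos (by exact_mod_cast one_le_siteScale S hS hdivS lvl zc hcover p.1) 2))
  -- the conjugated-pairing hypothesis along the site weight `κ·d_n(·, t_{k′})` = `hc_levelOp` verbatim
  have hcH : ∀ v : UT N × Cp → ℝ, ∑ p, μ₀ * ((siteScale S hS hdivS lvl zc hcover p.1 : ℝ) ^ 2)⁻¹ * v p ^ 2 ≤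
      ∑ p, Real.exp (κ * sdist bsrc btgt (siteScale S hS hdivS lvl zc hcover) p.1 tk') * v p *
        A (fun q => Real.exp (-(κ * sdist bsrc btgt (siteScale S hS hdivS lvl zc hcover) q.1 tk')) * v q) p :=
    fun v => hc_levelOp S hS hdivS lvl zc hdisj hcover Rm hRm T hT a ha ω hsupp hamax hscale c hc hcoer hκ0 hκ1 (tk', i₀) v
  -- thresholds on the two cells (K4 §6)
  have hthr := sdist_corner_thresholds S hS hdivS lvl zc hdisj hcover
  -- file 6
  refine real_set_norm_inverse_le hunit hμpos hκ0 hcH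
    (univ.filter (fun p : UT N × Cp => cellOf S hS hdivS lvl zc hcover p.1 = k))
    (univ.filter (fun p : UT N × Cp => cellOf S hS hdivS lvl zc hcover p.1 = k'))
    (fun p hp => hu p (fun h => hp (mem_filter.mpr ⟨mem_univ _, h⟩)))
    (mul_pos hμ (inv_pos.mpr (pow_pos (hSpos (lvl k)) 2)))
    (mul_pos hμ (inv_pos.mpr (pow_pos (hSpos (lvl k')) 2)))
    (fun p hp => ?_) (fun p hp => ?_) (fun p hp => ?_) (fun p hp => ?_)
  · -- target floor: `d_n(t_k, t_{k′}) − 2d ≤ d_n(p, t_{k′})` on cell `k`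
    have hpk : cellOf S hS hdivS lvl zc hcover p.1 = k := (mem_filter.mp hp).2
    have h := (hthr p.1 k').2
    rw [hpk] at h
    exact h
  · -- source oscillation: `d_n(p, t_{k′}) ≤ 2d` on cell `k′`
    exact (hthr p.1 k').1 (mem_filter.mp hp).2
  · -- profile on cell `k`: `n(p) = S_{l_k}`
    have hpk : cellOf S hS hdivS lvl zc hcover p.1 = k := (mem_filter.mp hp).2
    have hn : siteScale S hS hdivS lvl zc hcover p.1 = S (lvl k) := by rw [siteScale, hpk]
    rw [hn]
  · have hpk : cellOf S hS hdivS lvl zc hcover p.1 = k' := (mem_filter.mp hp).2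
    have hn : siteScale S hS hdivS lvl zc hcover p.1 = S (lvl k') := by rw [siteScale, hpk]
    rw [hn]

end

end Summit.QuantumFields.BalabanUV.Beta.MultiscaleCombesThomasL2Cells
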